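import Literature.Computability.QuantumComplexity.OracleSeparationBQPBPP
import Literature.Computability.QuantumComplexity.RazTalBoundedDepth
import Literature.Computability.Complexity.AlgebraicQueryRectangles
import HarnessLib

/-!
# The Forrelation distribution fools `BPP` machines querying the multilinear extension of an XOR-masked window

Topic `Literature/Computability/QuantumComplexity`; classical half of the algebraic oracle
separation `BQP^A ⊄ BPP^Ã` (Aaronson–Wigderson, *Algebrization*, Thm. 5.11(v); tree fact
`Literature.Computability.Complexity.aaronsonWigderson2009_bqp_not_subset_bpp`). Raz–Tal's
Appendix A oracle stores the Forrelation window `x_n` in the clear; against a machine with access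
to the *multilinear extension* of the oracle that layout is useless (one extension query returns an
exact sub-cube sum of a block, and products of such sums correlate with `x_n ∼ 𝒟₁`), so here the
window is **XOR-masked**: level `n` of the oracle holds a *double window* `(R, Y)` at the addresses
`rtAddr n i k ++ [0]` and `rtAddr n i k ++ [1]`, and the quantum machine reads `x_n = R ⊕ Y` with
two queries per phase. This file proves the analogue of Raz–Tal's Claim 8.2 for that layout and
for bounded-error probabilistic machines querying the multilinear extension:

* the layout: `xorWin`, `mAddrE`, `mPatchLevel` (level `n` of a background oracle overwritten by
  a double window, an instance of `dwPatch`); the masked window `mWindow` read by the quantum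
  machine is defined with the machine (`RazTalMaskedMachine.lean`);
* `extBase M q A` — the language of the `P^Ã` machine `(M, q)` run against the query-length
  cut-off of `Ã = multilinearExtension A` (for a genuine `PRel` machine the cut-off is invisible,
  `extBase_eq_of_PRel`), its locality (`extBase_congr`: only `A` below length `q(|z|)` matters);
  `extAcc M q p A z` — the acceptance probability over coins of length `p(|z|)`, and its locality
  `extAcc_congr` with the reach `extReach q p |z|`;
* **`fiberAvg_maskAvg_update`**: for every input `z`, block `j` and window `x`, the map
  `w ↦ 𝔼_R extAcc(A₀ patched by (R, R ⊕ x[j ↦ w]))` is a convex combination of XOR-fibres of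
  `K`-rectangle functions (`FiberAvg K`, files `XorFiberGrowth.lean`, `AlgebraicQueryRectangles.lean`:
  Aaronson–Wigderson's transfer principle), `K = (4^{B+1}+1)^{B+1}`, `B` the query bound at `z`;
* **`ext_gap_small`** (Claim 8.2 for `BPP^Ã`): for every `(M, q, p)`, from some level on and for
  every background, `|𝔼_{x∼𝒟₁} h(x) − 𝔼_{x∼U} h(x)| ≤ 1/10` for
  `h(x) = 𝔼_R extAcc(A₀ patched by (R, R ⊕ x))` at the probe `1ⁿ` — Raz–Tal's theorem
  `abs_integral_truncEval_sub_le` (fed with the Fourier growth `FiberAvg.l1Level_le`, closed under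
  restrictions) on each block, the hybrid argument `hybrid_bound` over the `m` blocks, and
  `poly(n)/2^{n/2} → 0`.

Everything is proved; no named facts.

## References

* S. Aaronson, A. Wigderson, *Algebrization: a new barrier in complexity theory*, STOC 2008 (full
  version), Thm. 4.11 (transfer principle), Thm. 5.11(v) and its proof sketch, p. 28
  [AaronsonWigderson2008].
* R. Raz, A. Tal, *Oracle separation of BQP and PH*, J. ACM 69 (2022), §7 (Thm. 7.4, the general
  bound for functions of small Fourier growth), Claim 8.2, App. A [RazTalJACM2022].
* U. Girish, R. Raz, A. Tal, *Quantum versus randomized communication complexity, with efficient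
  players*, ITCS 2021 (XOR-lifted Forrelation; Fourier growth of protocols).
-/

noncomputable section

namespace Literature.Computability.QuantumComplexity

open _root_.Computability Complexity Complexity.LowDegree Finset

/-! ### The XOR-masked layout -/

/-- Blockwise XOR of two windows (the quantum machine's view `x = R ⊕ Y` of a double window). [folklore] -/
def xorWin {n : ℕ} (R x : Window n) : Window n := fun i k => xor (R i k) (x i k)

/-- Pointwise form. [folklore] -/
@[simp] theorem xorWin_apply {n : ℕ} (R x : Window n) (i : Fin (rtBlocks n)) (k : Fin (2 * 2 ^ n)) :
    xorWin R x i k = xor (R i k) (x i k) := rfl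

/-- `R ⊕ (R ⊕ x) = x`. [folklore] -/
@[simp] theorem xorWin_xorWin_cancel {n : ℕ} (R x : Window n) : xorWin R (xorWin R x) = x := by
  funext i k; simp

/-- The positions of a level: (block, bit). [cite: RazTalJACM2022, App. A] -/
abbrev Idx (n : ℕ) : Type := Fin (rtBlocks n) × Fin (2 * 2 ^ n)

/-- **The masked addresses of level `n`**: position `(i, k)` is stored twice, at
`rtAddr n i k ++ [0]` (the mask bit `R i k`) and at `rtAddr n i k ++ [1]` (the bit `Y i k`);
length `ℓ(n) + 1`. [cite: AaronsonWigderson2008, Thm. 5.11 (v)] -/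
def mAddrE (n : ℕ) (p : Idx n × Bool) : List Bool := rtAddr n p.1.1 p.1.2 ++ [p.2]

/-- Masked addresses of level `n` have length `ℓ(n) + 1`. [folklore] -/
@[simp] theorem length_mAddrE (n : ℕ) (p : Idx n × Bool) : (mAddrE n p).length = rtLen n + 1 := by
  simp [mAddrE]

/-- The masked address map of a level is injective. [folklore] -/
theorem mAddrE_injective (n : ℕ) : Function.Injective (mAddrE n) := by
  rintro ⟨⟨i, k⟩, c⟩ ⟨⟨i', k'⟩, c'⟩ h
  simp only [mAddrE] at h
  obtain ⟨h1, h2⟩ := List.append_inj' h rfl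
  obtain ⟨rfl, rfl⟩ := rtAddr_inj h1
  simp only [List.cons.injEq, and_true] at h2
  subst h2
  rfl

/-- Masked addresses of different levels differ (different lengths). [folklore] -/
theorem mAddrE_ne_of_ne {n n' : ℕ} (h : n ≠ n') (p : Idx n × Bool) (p' : Idx n' × Bool) :
    mAddrE n p ≠ mAddrE n' p' := by
  intro he
  have := congrArg List.length he
  rw [length_mAddrE, length_mAddrE] at this
  exact h (rtLen_injective (by omega))

/-- **Level `n` of the background `A₀` overwritten by the double window `(R, Y)`.** [cite: AaronsonWigderson2008, Thm. 5.11 (v)] -/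
def mPatchLevel (A₀ : Language Bool) (n : ℕ) (RY : Window n × Window n) : Language Bool :=
  dwPatch A₀ (mAddrE n) (fun p => RY.1 p.1 p.2) (fun p => RY.2 p.1 p.2)

/-! ### `P^Ã` machines with coins: the base language, acceptance probabilities, locality -/

/-- **The language of the `P^Ã` machine `(M, q)`**: `M`, run for `q(|z|)` rounds against the
multilinear-extension oracle of `A` cut off at query length `q(|z|)`, accepts `z`. For a genuine
`PRel` machine (all queries of length `≤ q(|z|)`) the cut-off is invisible (`extBase_eq_of_PRel`).
[cite: BakerGillSolovay1975, §1] -/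
def extBase (M : OracleAlg Bool) (q : Polynomial ℕ) (A : Language Bool) : Language Bool :=
  {z | M.run (cutLen (q.eval z.length) (multilinearExtension A).toOracle) (q.eval z.length) z = some true}

/-- For a `P^Ã` machine respecting its query bound, `extBase` is the decided language. [cite: BakerGillSolovay1975, §1] -/
theorem extBase_eq_of_PRel {A L : Language Bool} {M : OracleAlg Bool} {q : Polynomial ℕ}
    (hq : ∀ x : List Bool, M.run (multilinearExtension A).toOracle (q.eval x.length) x =
        some (L.boolIndicator x) ∧
      ∀ y ∈ M.queries (multilinearExtension A).toOracle (q.eval x.length) x, y.length ≤ q.eval x.length) :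
    extBase M q A = L := by
  ext z
  obtain ⟨hrun, hlen⟩ := hq z
  have hcong : M.run (cutLen (q.eval z.length) (multilinearExtension A).toOracle) (q.eval z.length) z =
      M.run (multilinearExtension A).toOracle (q.eval z.length) z :=
    OracleAlg.run_congr M fun y hy => cutLen_of_le _ (hlen y hy)
  show M.run (cutLen (q.eval z.length) (multilinearExtension A).toOracle) (q.eval z.length) z = some true ↔ z ∈ L
  rw [hcong, hrun, Option.some.injEq]
  exact (Set.mem_iff_boolIndicator _ _).symm

/-- **Locality of `extBase`**: languages agreeing on all strings of length `≤ q(|z|)` give the same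
verdict on `z` (queries of length `≤ q(|z|)` concern arities `≤ q(|z|)`, and the arity-`m` polynomial
of the multilinear extension depends on the length-`m` slice only). [cite: AaronsonWigderson2008, §4.1] -/
theorem extBase_congr (M : OracleAlg Bool) (q : Polynomial ℕ) {A A' : Language Bool} (z : List Bool)
    (h : ∀ s : List Bool, s.length ≤ q.eval z.length → (s ∈ A ↔ s ∈ A')) :
    z ∈ extBase M q A ↔ z ∈ extBase M q A' := by
  have hO : cutLen (q.eval z.length) (multilinearExtension A).toOracle =
      cutLen (q.eval z.length) (multilinearExtension A').toOracle := by
    funext y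
    unfold cutLen
    split_ifs with hy
    · exact ExtensionOracle.toOracle_congr_of_length (ℓ := q.eval z.length)
        (fun p m hm => multilinearExtension_poly_congr (sliceFn_congr fun w hw => h w (hw ▸ hm)) p) hy
    · rfl
  show M.run (cutLen (q.eval z.length) (multilinearExtension A).toOracle) (q.eval z.length) z = some true ↔
    M.run (cutLen (q.eval z.length) (multilinearExtension A').toOracle) (q.eval z.length) z = some true
  rw [hO]

/-- **The acceptance probability** of the description `(M, q, p)` at `z` relative to `A`: the
fraction of coin strings `r ∈ {0,1}^{p(|z|)}` with `⟨z, r⟩ ∈ extBase M q A`.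
[cite: AroraBarak2009, Def. 7.3] -/
def extAcc (M : OracleAlg Bool) (q p : Polynomial ℕ) (A : Language Bool) (z : List Bool) : ℝ :=
  uniformProb (p.eval z.length) {r | boolPair z r ∈ extBase M q A}

/-- Acceptance probabilities lie in `[0, 1]`. [folklore] -/
theorem extAcc_nonneg (M : OracleAlg Bool) (q p : Polynomial ℕ) (A : Language Bool) (z : List Bool) :
    0 ≤ extAcc M q p A z := uniformProb_nonneg _ _

/-- Acceptance probabilities lie in `[0, 1]`. [folklore] -/
theorem extAcc_le_one (M : OracleAlg Bool) (q p : Polynomial ℕ) (A : Language Bool) (z : List Bool) :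
    extAcc M q p A z ≤ 1 := uniformProb_le_one _ _

/-- The query bound at the paired inputs `⟨z, r⟩`, `|r| = p(|z|)`. [cite: BakerGillSolovay1975, §1] -/
def extReach (q p : Polynomial ℕ) (n : ℕ) : ℕ := q.eval (2 * n + 2 + p.eval n)

/-- **Locality of the acceptance probability**: languages agreeing below the reach give the same
acceptance probability. [cite: BakerGillSolovay1975, §1] -/
theorem extAcc_congr (M : OracleAlg Bool) (q p : Polynomial ℕ) {A A' : Language Bool} (z : List Bool)
    (h : ∀ s : List Bool, s.length ≤ extReach q p z.length → (s ∈ A ↔ s ∈ A')) :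
    extAcc M q p A z = extAcc M q p A' z := by
  unfold extAcc
  rw [uniformProb_eq_cnt_div, uniformProb_eq_cnt_div, cnt_congr]
  intro r hr
  simp only [Set.mem_setOf_eq]
  refine extBase_congr M q (boolPair z r) fun s hs => h s ?_
  rw [length_boolPair, hr] at hs
  exact hs

open Classical in
/-- **The acceptance probability as an average of acceptance indicators over the coins.**
[cite: AroraBarak2009, Def. 7.3] -/
theorem extAcc_eq_sum (M : OracleAlg Bool) (q p : Polynomial ℕ) (A : Language Bool) (z : List Bool) :
    extAcc M q p A z =
      (∑ r : List.Vector Bool (p.eval z.length),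
        (if boolPair z r.toList ∈ extBase M q A then (1 : ℝ) else 0)) / 2 ^ (p.eval z.length) := by
  classical
  unfold extAcc
  rw [uniformProb_eq_cnt_div, cnt]
  congr 1
  rw [Finset.sum_boole]
  congr 1

/-! ### The window statistic of a `BPP^Ã` description is a convex combination of XOR-fibres -/

section Fiber

variable (M : OracleAlg Bool) (q p : Polynomial ℕ) (A₀ : Language Bool) (n : ℕ) (z : List Bool)

/-- **The statistic `h(x) = 𝔼_R extAcc(A₀ patched by (R, R ⊕ x))`**: the acceptance probability at
`z`, averaged over a uniformly random mask. [cite: AaronsonWigderson2008, Thm. 5.11 (v)] -/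
def maskAvg (x : Window n) : ℝ :=
  (∑ R : Window n, extAcc M q p (mPatchLevel A₀ n (R, xorWin R x)) z) / Fintype.card (Window n)

/-- The statistic lies in `[0, 1]`. [folklore] -/
theorem maskAvg_nonneg (x : Window n) : 0 ≤ maskAvg M q p A₀ n z x :=
  div_nonneg (sum_nonneg fun _ _ => extAcc_nonneg _ _ _ _ _) (Nat.cast_nonneg _)

/-- The statistic lies in `[0, 1]`. [folklore] -/
theorem maskAvg_le_one (x : Window n) : maskAvg M q p A₀ n z x ≤ 1 := by
  unfold maskAvg
  have hcard : (0 : ℝ) < Fintype.card (Window n) := by exact_mod_cast Fintype.card_pos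
  rw [div_le_one hcard]
  calc ∑ R : Window n, extAcc M q p (mPatchLevel A₀ n (R, xorWin R x)) z ≤ ∑ _R : Window n, (1 : ℝ) :=
        sum_le_sum fun R _ => extAcc_le_one _ _ _ _ _
    _ = Fintype.card (Window n) := by simp

/-- The acceptance indicator of the coin string `r`, as a function of the double window. [folklore] -/
def accInd (zr : List Bool) (R Y : Window n) : ℝ :=
  if M.runAux (cutLen (q.eval zr.length) (multilinearExtension (mPatchLevel A₀ n (R, Y))).toOracle) zr
      (q.eval zr.length) [] = some true then 1 else 0

variable {M q p A₀ n z}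

/-- **The acceptance indicator is a `K`-rectangle function of the double window**
(`isRectSimple_accept_multilinearExtension` for the masked layout). [cite: AaronsonWigderson2008, Thm. 4.11] -/
theorem isRectSimple_accInd (zr : List Bool) :
    IsRectSimple ((2 ^ (q.eval zr.length + 1) * 2 ^ (q.eval zr.length + 1) + 1) ^ (q.eval zr.length + 1))
      (accInd M q A₀ n zr) := by
  have h := isRectSimple_accept_multilinearExtension (A₀ := A₀) (B := q.eval zr.length)
    (mAddrE_injective n) M zr (q.eval zr.length)
  have h' := h.comap (fun R : Window n => fun p : Idx n => R p.1 p.2) (fun Y : Window n => fun p : Idx n => Y p.1 p.2)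
  exact h'

/-- Updating a window at block `j` commutes with the blockwise XOR. [folklore] -/
theorem update_xorWin (R x : Window n) (j : Fin (rtBlocks n)) (X w : Fin (2 * 2 ^ n) → Bool) :
    Function.update (xorWin R x) j (xorVec X w) = xorWin (Function.update R j X) (Function.update x j w) := by
  funext i k
  by_cases hi : i = j
  · subst hi; simp
  · simp [Function.update_of_ne hi]

/-- **The restriction of the statistic to block `j` is a convex combination of XOR-fibres of
`K`-rectangle functions** (index the combination by a coin string and a full mask `R`; the fibre of
`(X, X') ↦ [accept on (R[j ↦ X], (R ⊕ x)[j ↦ X'])]` averages over the block-`j` mask).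
[cite: AaronsonWigderson2008, Thm. 4.11] -/
theorem fiberAvg_maskAvg_update (j : Fin (rtBlocks n)) (x : Window n) :
    FiberAvg ((2 ^ (q.eval (2 * z.length + 2 + p.eval z.length) + 1) *
        2 ^ (q.eval (2 * z.length + 2 + p.eval z.length) + 1) + 1) ^
          (q.eval (2 * z.length + 2 + p.eval z.length) + 1))
      fun w => maskAvg M q p A₀ n z (Function.update x j w) := by
  classical
  set B := q.eval (2 * z.length + 2 + p.eval z.length) with hB
  have hcardW : (0 : ℝ) < Fintype.card (Window n) := by exact_mod_cast Fintype.card_pos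
  have hlenzr : ∀ r : List.Vector Bool (p.eval z.length), (boolPair z r.toList).length =
      2 * z.length + 2 + p.eval z.length := fun r => by
    rw [length_boolPair, List.Vector.toList_length]
  refine ⟨List.Vector Bool (p.eval z.length) × Window n, inferInstance,
    fun _ => 1 / (2 ^ (p.eval z.length) * Fintype.card (Window n)),
    fun ι => fun X X' => accInd M q A₀ n (boolPair z ι.1.toList) (Function.update ι.2 j X)
      (Function.update (xorWin ι.2 x) j X'),
    fun _ => by positivity, ?_, ?_, ?_⟩
  · -- the weights sum to one
    simp only [sum_const, card_univ, Fintype.card_prod, card_vector, Fintype.card_bool, nsmul_eq_mul]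
    push_cast
    field_simp
  · -- each function is a `K`-rectangle function
    intro ι
    have h := (isRectSimple_accInd (M := M) (q := q) (A₀ := A₀) (n := n) (boolPair z ι.1.toList)).comap
      (fun X : Fin (2 * 2 ^ n) → Bool => Function.update ι.2 j X)
      (fun X' : Fin (2 * 2 ^ n) → Bool => Function.update (xorWin ι.2 x) j X')
    rw [hlenzr] at h
    exact h
  · -- the identity
    intro w
    rw [Fintype.sum_prod_type]
    simp only [maskAvg, extAcc_eq_sum, xorFiber]
    -- rewrite both sides as the same triple sum
    have hacc : ∀ (r : List.Vector Bool (p.eval z.length)) (RY : Window n × Window n),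
        (if boolPair z r.toList ∈ extBase M q (mPatchLevel A₀ n RY) then (1 : ℝ) else 0) =
          accInd M q A₀ n (boolPair z r.toList) RY.1 RY.2 := by
      intro r RY
      unfold accInd
      congr 1
    simp only [hacc]
    -- LHS: (∑ R, (∑ r, acc r (R, R ⊕ x')) / 2^p) / |W|,  x' = x[j ↦ w]
    -- RHS: ∑ r, ∑ R, μ * ((∑ X, acc r (R[j↦X], (R⊕x)[j ↦ X ⊕ w])) / 2^{2N})
    have key : ∀ r : List.Vector Bool (p.eval z.length),
        ∑ R : Window n, (∑ X : Fin (2 * 2 ^ n) → Bool,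
          accInd M q A₀ n (boolPair z r.toList) (Function.update R j X)
            (Function.update (xorWin R x) j (xorVec X w))) =
          Fintype.card (Fin (2 * 2 ^ n) → Bool) *
            ∑ R : Window n, accInd M q A₀ n (boolPair z r.toList) R (xorWin R (Function.update x j w)) := by
      intro r
      have h := sum_eq_sum_sum_update_div
        (fun R : Window n => accInd M q A₀ n (boolPair z r.toList) R (xorWin R (Function.update x j w))) j
      have hc : (0 : ℝ) < Fintype.card (Fin (2 * 2 ^ n) → Bool) := by exact_mod_cast Fintype.card_pos
      rw [eq_div_iff hc.ne', mul_comm] at h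
      have h2 : ∑ R : Window n, (∑ X : Fin (2 * 2 ^ n) → Bool,
          accInd M q A₀ n (boolPair z r.toList) (Function.update R j X)
            (Function.update (xorWin R x) j (xorVec X w))) =
          ∑ R : Window n, ∑ X : Fin (2 * 2 ^ n) → Bool,
            accInd M q A₀ n (boolPair z r.toList) (Function.update R j X)
              (xorWin (Function.update R j X) (Function.update x j w)) :=
        sum_congr rfl fun R _ => sum_congr rfl fun X _ => by rw [update_xorWin]
      rw [h2]
      exact h.symm
    simp_rw [← sum_div, div_div]
    rw [sum_comm]
    simp_rw [← mul_sum, ← sum_div]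
    simp_rw [key]
    rw [← mul_sum, card_block, mul_div_cancel_left₀ _ (by positivity)]
    ring

end Fiber

/-! ### Claim 8.2 for `BPP^Ã` descriptions -/

/-- **One block**: a convex combination of XOR-fibres of `K`-rectangle functions on `{0,1}^{2N}`
cannot tell `𝒟` from uniform — Raz–Tal's theorem `abs_integral_truncEval_sub_le` with the Fourier
growth `L = 2e(ln K + 3)` of the class (`FiberAvg.l1Level_le`, closed under restrictions by
`FiberAvg.piecewise`). [cite: RazTalJACM2022, Thm. 7.4 (proof)] -/
theorem block_gap_of_fiberAvg {n : ℕ} (hn : 2 ≤ n) {K : ℕ} (hK : 1 ≤ K)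
    {g : (Fin (2 * 2 ^ n) → Bool) → ℝ} (hg : FiberAvg K g)
    (hwlog : 16 * (razTalEps (2 ^ n) * growthConst K ^ 2) ≤ Real.sqrt ((2 ^ n : ℕ) : ℝ)) :
    |∑ w, (razTalDistribution n w).toReal * g w - (∑ w, g w) / Fintype.card (Fin (2 * 2 ^ n) → Bool)| ≤
      12 * razTalEps (2 ^ n) * growthConst K ^ 2 / Real.sqrt ((2 ^ n : ℕ) : ℝ) + 16 / ((2 ^ n : ℕ) : ℝ) := by
  rw [sum_razTalDistribution_mul, card_block, ← cubeFourierCoeff_empty]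
  refine abs_integral_truncEval_sub_le hn g (fun w => hg.abs_le_one w) (growthConst_pos hK).le ?_ hwlog
  intro J σ k hk
  exact ((hg.piecewise J σ).l1Level_le hk)

/-- The rectangle count of the description `(M, q, p)` at level `n` (probe `1ⁿ`):
`K(n) = (4^{B+1} + 1)^{B+1}`, `B = q(2n + 2 + p(n))`. [cite: AaronsonWigderson2008, Thm. 4.11] -/
def extRectCount (q p : Polynomial ℕ) (n : ℕ) : ℕ :=
  (2 ^ (extReach q p n + 1) * 2 ^ (extReach q p n + 1) + 1) ^ (extReach q p n + 1)

/-- `K(n) ≥ 1`. [folklore] -/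
theorem one_le_extRectCount (q p : Polynomial ℕ) (n : ℕ) : 1 ≤ extRectCount q p n :=
  Nat.one_le_pow _ _ (Nat.succ_pos _)

/-- **The growth parameter is polynomial in `n`**: `L(K(n))² ≤ C · n^D` for `n ≥ 1`. [folklore] -/
theorem growthConst_extRectCount_sq_le (q p : Polynomial ℕ) :
    ∃ (C : ℝ) (D : ℕ), 0 < C ∧ ∀ n : ℕ, 1 ≤ n → growthConst (extRectCount q p n) ^ 2 ≤ C * (n : ℝ) ^ D := by
  -- the size polynomial `B(n) = q(2n + 2 + p(n))`
  set S : Polynomial ℕ := q.comp (Polynomial.C 2 * Polynomial.X + Polynomial.C 2 + p) with hS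
  have hSeval : ∀ n : ℕ, S.eval n = extReach q p n := fun n => by
    simp [hS, extReach, Polynomial.eval_comp]
  obtain ⟨K₁, D, hK₁, hSle⟩ := exists_monomial_bound S
  refine ⟨(6 * Real.exp 1 * (K₁ + 1) ^ 2) ^ 2, 4 * D, by positivity, fun n hn => ?_⟩
  have hn' : (1 : ℝ) ≤ n := by exact_mod_cast hn
  set B : ℕ := extReach q p n with hB
  have hB2 : (B : ℝ) + 2 ≤ (K₁ + 1) * (n : ℝ) ^ D := by
    have h := hSle n hn
    rw [hSeval] at h
    have hnD : (1 : ℝ) ≤ (n : ℝ) ^ D := one_le_pow₀ hn'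
    nlinarith
  -- `ln K ≤ 2 (B+1)(B+2)`
  have hK : (extRectCount q p n : ℝ) = ((2 : ℝ) ^ (B + 1) * 2 ^ (B + 1) + 1) ^ (B + 1) := by
    simp [extRectCount, hB]
  have hlogK : Real.log (extRectCount q p n) ≤ 2 * ((B : ℝ) + 1) * ((B : ℝ) + 2) := by
    rw [hK, Real.log_pow]
    have h4 : (2 : ℝ) ^ (B + 1) * 2 ^ (B + 1) + 1 ≤ 4 ^ (B + 2) := by
      have h1 : (2 : ℝ) ^ (B + 1) * 2 ^ (B + 1) = 4 ^ (B + 1) := by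
        rw [← mul_pow]; norm_num
      rw [h1, pow_succ (4 : ℝ) (B + 1)]
      have : (1 : ℝ) ≤ 4 ^ (B + 1) := one_le_pow₀ (by norm_num)
      linarith
    have hlog4 : Real.log (4 ^ (B + 2) : ℝ) = (B + 2 : ℕ) * Real.log 4 := by
      rw [Real.log_pow]
    have hl4 : Real.log 4 ≤ 2 := by
      have := Real.log_le_sub_one_of_pos (show (0 : ℝ) < 4 by norm_num)
      have h2 : Real.log 4 = 2 * Real.log 2 := by
        rw [show (4 : ℝ) = 2 ^ 2 by norm_num, Real.log_pow]; norm_num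
      rw [h2]; linarith [Real.log_two_lt_d9]
    have hle : Real.log ((2 : ℝ) ^ (B + 1) * 2 ^ (B + 1) + 1) ≤ ((B : ℝ) + 2) * 2 := by
      calc Real.log ((2 : ℝ) ^ (B + 1) * 2 ^ (B + 1) + 1) ≤ Real.log (4 ^ (B + 2)) :=
            Real.log_le_log (by positivity) h4
        _ = (B + 2 : ℕ) * Real.log 4 := hlog4
        _ ≤ (B + 2 : ℕ) * 2 := mul_le_mul_of_nonneg_left hl4 (Nat.cast_nonneg _)
        _ = ((B : ℝ) + 2) * 2 := by push_cast; ring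
    have hlog0 : 0 ≤ Real.log ((2 : ℝ) ^ (B + 1) * 2 ^ (B + 1) + 1) := Real.log_nonneg (by
      have : (1 : ℝ) ≤ 2 ^ (B + 1) * 2 ^ (B + 1) := one_le_mul_of_one_le_of_one_le (one_le_pow₀ (by norm_num))
        (one_le_pow₀ (by norm_num))
      linarith)
    calc ((B + 1 : ℕ) : ℝ) * Real.log ((2 : ℝ) ^ (B + 1) * 2 ^ (B + 1) + 1)
        ≤ ((B + 1 : ℕ) : ℝ) * (((B : ℝ) + 2) * 2) := mul_le_mul_of_nonneg_left hle (Nat.cast_nonneg _)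
      _ = 2 * ((B : ℝ) + 1) * ((B : ℝ) + 2) := by push_cast; ring
  -- `L ≤ 6e (B+2)²`
  have hL : growthConst (extRectCount q p n) ≤ 6 * Real.exp 1 * ((B : ℝ) + 2) ^ 2 := by
    unfold growthConst
    have hB0 : (0 : ℝ) ≤ B := Nat.cast_nonneg _
    have : Real.log (extRectCount q p n) + 3 ≤ 3 * ((B : ℝ) + 2) ^ 2 := by nlinarith
    calc 2 * Real.exp 1 * (Real.log (extRectCount q p n) + 3) ≤ 2 * Real.exp 1 * (3 * ((B : ℝ) + 2) ^ 2) :=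
          mul_le_mul_of_nonneg_left this (by positivity)
      _ = 6 * Real.exp 1 * ((B : ℝ) + 2) ^ 2 := by ring
  have hL0 : 0 ≤ growthConst (extRectCount q p n) := (growthConst_pos (one_le_extRectCount q p n)).le
  calc growthConst (extRectCount q p n) ^ 2 ≤ (6 * Real.exp 1 * ((B : ℝ) + 2) ^ 2) ^ 2 :=
        pow_le_pow_left₀ hL0 hL 2
    _ ≤ (6 * Real.exp 1 * ((K₁ + 1) * (n : ℝ) ^ D) ^ 2) ^ 2 := by
        have hB20 : (0 : ℝ) ≤ (B : ℝ) + 2 := by positivity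
        gcongr
    _ = (6 * Real.exp 1 * (K₁ + 1) ^ 2) ^ 2 * (n : ℝ) ^ (4 * D) := by ring

/-- **Raz–Tal, Claim 8.2, for bounded-error probabilistic machines querying the multilinear
extension of the XOR-masked oracle**: for every `P^Ã` machine `M` with bound `q` and coin
polynomial `p`, from some level `n` on, for every background oracle, the statistic
`h(x) = 𝔼_R extAcc(A₀ patched at level n by (R, R ⊕ x))` at the probe `1ⁿ` has
`|𝔼_{𝒟₁} h − 𝔼_U h| ≤ 1/10` (per block `block_gap_of_fiberAvg` with `fiberAvg_maskAvg_update`,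
the hybrid argument over the `m = rtBlocks n` blocks, and `poly(n)/2^{n/2} → 0`).
[cite: RazTalJACM2022, Claim 8.2] [cite: AaronsonWigderson2008, Thm. 5.11 (v)] -/
theorem ext_gap_small (M : OracleAlg Bool) (q p : Polynomial ℕ) :
    ∃ n₀ : ℕ, ∀ n, n₀ ≤ n → ∀ A₀ : Language Bool,
      |∑ x : Window n, rtD1 n x * maskAvg M q p A₀ n (List.replicate n true) x -
          (∑ x : Window n, maskAvg M q p A₀ n (List.replicate n true) x) / Fintype.card (Window n)| ≤
        1 / 10 := by
  obtain ⟨C, D, hC, hLsq⟩ := growthConst_extRectCount_sq_le q p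
  -- the per-block bound and its eventual smallness
  set b : ℕ → ℝ := fun n => rtBlocks n *
    (12 * razTalEps (2 ^ n) * growthConst (extRectCount q p n) ^ 2 / Real.sqrt ((2 ^ n : ℕ) : ℝ) +
      16 / ((2 ^ n : ℕ) : ℝ)) with hb
  have hsqrt_le : ∀ n : ℕ, Real.sqrt ((2 ^ n : ℕ) : ℝ) ≤ ((2 ^ n : ℕ) : ℝ) := fun n => by
    rw [Real.sqrt_le_left (by positivity)]
    have h1 : (1 : ℝ) ≤ ((2 ^ n : ℕ) : ℝ) := by exact_mod_cast Nat.one_le_two_pow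
    nlinarith
  have hdom : ∀ n, 1 ≤ n → b n ≤ (18496 * (12 * C + 16)) * (n : ℝ) ^ (3 + D) / Real.sqrt 2 ^ n := by
    intro n hn
    have hn' : (1 : ℝ) ≤ n := by exact_mod_cast hn
    have heps : razTalEps (2 ^ n) ≤ 1 := (razTalEps_le_half hn).trans (by norm_num)
    have heps0 : 0 ≤ razTalEps (2 ^ n) := razTalEps_nonneg _
    have hL2 := hLsq n hn
    have hsq : 0 < Real.sqrt ((2 ^ n : ℕ) : ℝ) := Real.sqrt_pos.2 (by positivity)
    have hnD : (1 : ℝ) ≤ (n : ℝ) ^ D := one_le_pow₀ hn'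
    have h1 : 12 * razTalEps (2 ^ n) * growthConst (extRectCount q p n) ^ 2 / Real.sqrt ((2 ^ n : ℕ) : ℝ) ≤
        12 * C * (n : ℝ) ^ D / Real.sqrt ((2 ^ n : ℕ) : ℝ) := by
      refine div_le_div_of_nonneg_right ?_ hsq.le
      have hg0 : 0 ≤ growthConst (extRectCount q p n) ^ 2 := sq_nonneg _
      calc 12 * razTalEps (2 ^ n) * growthConst (extRectCount q p n) ^ 2
          ≤ 12 * 1 * (C * (n : ℝ) ^ D) := by
            refine mul_le_mul (mul_le_mul_of_nonneg_left heps (by norm_num)) hL2 hg0 (by norm_num)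
        _ = 12 * C * (n : ℝ) ^ D := by ring
    have h2 : 16 / ((2 ^ n : ℕ) : ℝ) ≤ 16 * (n : ℝ) ^ D / Real.sqrt ((2 ^ n : ℕ) : ℝ) := by
      calc 16 / ((2 ^ n : ℕ) : ℝ) ≤ 16 / Real.sqrt ((2 ^ n : ℕ) : ℝ) :=
            div_le_div_of_nonneg_left (by norm_num) hsq (hsqrt_le n)
        _ ≤ 16 * (n : ℝ) ^ D / Real.sqrt ((2 ^ n : ℕ) : ℝ) := by
            refine div_le_div_of_nonneg_right ?_ hsq.le
            nlinarith
    have hm : (rtBlocks n : ℝ) = 18496 * (n : ℝ) ^ 3 := by simp [rtBlocks]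
    calc b n ≤ rtBlocks n * (12 * C * (n : ℝ) ^ D / Real.sqrt ((2 ^ n : ℕ) : ℝ) +
          16 * (n : ℝ) ^ D / Real.sqrt ((2 ^ n : ℕ) : ℝ)) := by
          rw [hb]; exact mul_le_mul_of_nonneg_left (add_le_add h1 h2) (Nat.cast_nonneg _)
      _ = (18496 * (12 * C + 16)) * (n : ℝ) ^ (3 + D) / Real.sqrt 2 ^ n := by
          rw [hm, sqrt_two_pow_natCast, pow_add]; ring
  obtain ⟨n₁, hn₁⟩ := eventually_le_of_poly_div_exp hdom (t := 1 / 10) (by norm_num)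
  -- the side condition `16 ε L² ≤ √N`, eventually
  set b' : ℕ → ℝ := fun n => 16 * growthConst (extRectCount q p n) ^ 2 / Real.sqrt ((2 ^ n : ℕ) : ℝ) with hb'
  have hdom' : ∀ n, 1 ≤ n → b' n ≤ (16 * C) * (n : ℝ) ^ D / Real.sqrt 2 ^ n := by
    intro n hn
    have hL2 := hLsq n hn
    have hsq : 0 < Real.sqrt ((2 ^ n : ℕ) : ℝ) := Real.sqrt_pos.2 (by positivity)
    rw [hb']
    simp only
    rw [sqrt_two_pow_natCast] at hsq ⊢
    refine div_le_div_of_nonneg_right ?_ hsq.le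
    nlinarith
  obtain ⟨n₂, hn₂⟩ := eventually_le_of_poly_div_exp hdom' (t := 1) (by norm_num)
  refine ⟨max (max n₁ n₂) 2, fun n hn A₀ => ?_⟩
  have hn1 : n₁ ≤ n := le_trans (le_trans (le_max_left _ _) (le_max_left _ _)) hn
  have hn2 : n₂ ≤ n := le_trans (le_trans (le_max_right _ _) (le_max_left _ _)) hn
  have hn_two : 2 ≤ n := (le_max_right _ _).trans hn
  have hone : 1 ≤ n := le_trans (by norm_num) hn_two
  -- the side condition at `n`
  have hwlog : 16 * (razTalEps (2 ^ n) * growthConst (extRectCount q p n) ^ 2) ≤ Real.sqrt ((2 ^ n : ℕ) : ℝ) := by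
    have h := hn₂ n hn2
    rw [hb'] at h
    simp only at h
    have hsq : 0 < Real.sqrt ((2 ^ n : ℕ) : ℝ) := Real.sqrt_pos.2 (by positivity)
    rw [div_le_one hsq] at h
    have heps : razTalEps (2 ^ n) ≤ 1 := (razTalEps_le_half hone).trans (by norm_num)
    have hg0 : 0 ≤ growthConst (extRectCount q p n) ^ 2 := sq_nonneg _
    calc 16 * (razTalEps (2 ^ n) * growthConst (extRectCount q p n) ^ 2)
        ≤ 16 * (1 * growthConst (extRectCount q p n) ^ 2) :=
          mul_le_mul_of_nonneg_left (mul_le_mul_of_nonneg_right heps hg0) (by norm_num)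
      _ = 16 * growthConst (extRectCount q p n) ^ 2 := by ring
      _ ≤ Real.sqrt ((2 ^ n : ℕ) : ℝ) := h
  -- the hybrid argument
  set f : Window n → ℝ := maskAvg M q p A₀ n (List.replicate n true) with hf
  have hc0 : ∀ w : Fin (2 * 2 ^ n) → Bool, 0 ≤ (razTalDistribution n w).toReal := fun _ => ENNReal.toReal_nonneg
  have hc1 : ∑ w : Fin (2 * 2 ^ n) → Bool, (razTalDistribution n w).toReal = 1 := sum_toReal_pmf_eq_one _
  have hlen : (List.replicate n true).length = n := by simp
  have hB : ∀ (j : Fin (rtBlocks n)) (x : Window n),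
      |∑ w, (razTalDistribution n w).toReal * f (Function.update x j w) -
          (∑ w, f (Function.update x j w)) / Fintype.card (Fin (2 * 2 ^ n) → Bool)| ≤
        12 * razTalEps (2 ^ n) * growthConst (extRectCount q p n) ^ 2 / Real.sqrt ((2 ^ n : ℕ) : ℝ) +
          16 / ((2 ^ n : ℕ) : ℝ) := by
    intro j x
    have hfa := fiberAvg_maskAvg_update (M := M) (q := q) (p := p) (A₀ := A₀) (n := n)
      (z := List.replicate n true) j x
    rw [hlen] at hfa
    exact block_gap_of_fiberAvg hn_two (one_le_extRectCount q p n) hfa hwlog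
  have hhyb := hybrid_bound hc0 hc1 f hB Finset.univ
  simp only [hybridWeight_univ, hybridWeight_empty, Finset.card_univ, Fintype.card_fin] at hhyb
  have hD1 : ∀ x : Window n, ∏ i, (razTalDistribution n (x i)).toReal = rtD1 n x := fun x => rfl
  simp only [hD1] at hhyb
  have hsum : ∑ x : Window n, 1 / (Fintype.card (Window n) : ℝ) * f x = (∑ x, f x) / Fintype.card (Window n) := by
    rw [← Finset.mul_sum, one_div_mul_eq_div]
  rw [hsum] at hhyb
  refine hhyb.trans ?_
  have h := hn₁ n hn1
  rw [hb] at h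
  exact h

end Literature.Computability.QuantumComplexity

end
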